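import Mathlib
import Summits.Ventures.FusionMHD.Models.SolovevMercierAxisRegular
import HarnessLib

/-!
# Axis-regular Mercier slope/intercept on the Lee–Cerfon / PCF Solov'ev family — §4–§5: the (8.134) loop integrals as
# regular integrals, the defect identity, `N₂ = (k²rW₁)²·M₂`, `N₀ = (k²rW₁)²·M₀`, and `MercierCriterion ↔ N₀ < g²·N₂`

Second of three files (`SolovevMercierAxisRegular.lean` = §1–§3: the kernel `Q`, the divided-difference kernels `d₃, d₅`,
joint continuity, the nine regular integrals `W₁, I_B, I₆, I₇, I₈, I_X, I_Y, D₃, D₅` and the numerators `N₂ = lcRegSlopeNum`,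
`N₀ = lcRegInterceptNum`; `…Limit.lean` = §6).  Venture LADDER-GRIDFUSION rung F1.MERCIER, cell `gridfusion`,
seat gridfusion-model-7 (g4), 2026-08-27.  Sources: Jardin 2010 (8.134) [bib `Jardin2010`] on model-5's record `lcGGJData`
(`SolovevFluxSurfaceGGJData/Quadratic/Threshold`); loop of Lee–Cerfon 2015 §4.1 [bib `LeeCerfon2015`].
* §4 `∫w = (R₀³q₀/F_B)W₁`, `∫w/u = (R₀³q₀/F_B)I_B`, `∫∂w/∂r = −(R₀³q₀/F_B)R₀·r·D₃`, `∫₀^π lcQKernelDr = −3R₀·r·D₅`,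
  `∫w/G, ∫w/(uG), ∫uw/G = (R₀³q₀/F_B)/(k²r²)·I₆, I₇, I₈`; `I₈ = R₀²(I₆ + rI_X)`, `R₀²I₇ = I₆ − rI_X + r²I_Y`; the
  DEFECT IDENTITY `R₀²(I₆² − I₇I₈) = r²(R₀²I_X² − I₈I_Y)`.
* §5 the six (8.134) ratios in regular form; **`N₂ = (k²rW₁)²·M₂`, `N₀ = (k²rW₁)²·M₀`**; `N₀ > 0`; `0 < M₂ ↔ 0 < N₂`;
  **`MercierCriterion ↔ N₀(r) < g²·N₂(r)`** and the per-cell forms; `g_M = √(N₀/N₂)`.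
HONEST FRAMING: exact real analysis about MODEL objects (ideal MHD, analytic fixed-boundary Solov'ev family); Mercier is a
NECESSARY local criterion; nothing here is a stability claim, an enclosure or an instance.
-/

noncomputable section

open Real Set MeasureTheory intervalIntegral Filter Topology
open Literature.MathematicalPhysics.MHD Literature.MathematicalPhysics.MHD.Solovev
open Literature.MathematicalPhysics.MHD.GradShafranov Literature.MathematicalPhysics.MHD.Mercier.FluxForm

namespace Summit.Ventures.FusionMHD.Models

namespace LcMercierRegular

/-! ## §4 The loop integrals of (8.134) as regular integrals (the `1/r`'s cancel exactly) -/

section identities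

variable {R₀ κ FB q₀ r : ℝ} (hR₀ : 0 < R₀) (hκ : 0 < κ) (hFB : 0 < FB) (hq₀ : 0 < q₀)
  (hr : 0 ≤ r) (h2r : 2 * r < R₀)
include hR₀ hκ hFB hq₀ hr h2r

/-- `∫₀^{2π} w = (R₀³q₀/F_B)·W₁`. [cite: Jardin2010, §5.3 eq. (5.29)] -/
theorem integral_lcAvgWeight_eq_regI0 :
    ∫ t in (0 : ℝ)..(2 * π), lcAvgWeight κ FB R₀ q₀ r t = R₀ ^ 3 * q₀ / FB * lcRegI0 R₀ r := by
  have hu := lcU_pos hR₀ hr h2r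
  unfold lcRegI0
  rw [← intervalIntegral.integral_const_mul]
  exact intervalIntegral.integral_congr fun t _ => lcAvgWeight_eq hκ.ne' hFB.ne' hR₀.ne' hq₀.ne' (hu t)

/-- `∫₀^{2π} w/u = (R₀³q₀/F_B)·I_B`. [cite: Jardin2010, §5.3 eq. (5.30)] -/
theorem integral_lcAvgWeight_div_lcU_eq :
    ∫ t in (0 : ℝ)..(2 * π), lcAvgWeight κ FB R₀ q₀ r t / lcU R₀ r t = R₀ ^ 3 * q₀ / FB * lcRegIB R₀ r := by
  have hu := lcU_pos hR₀ hr h2r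
  unfold lcRegIB
  rw [← intervalIntegral.integral_const_mul]
  refine intervalIntegral.integral_congr fun t _ => ?_
  rw [lcAvgWeight_eq hκ.ne' hFB.ne' hR₀.ne' hq₀.ne' (hu t)]
  have h1 : lcU R₀ r t ≠ 0 := (hu t).ne'
  have h2 : Real.sqrt (lcU R₀ r t) ≠ 0 := (Real.sqrt_pos.2 (hu t)).ne'
  field_simp

/-- `∫₀^{2π} ∂w/∂r = −(R₀³q₀/F_B)·R₀·r·D₃` (the `cos t·R₀⁻³` part integrates to `0`). [cite: Jardin2010, §8.5.4 eq. (8.134)] -/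
theorem integral_lcAvgWeightDr_eq_regD3 :
    ∫ t in (0 : ℝ)..(2 * π), lcAvgWeightDr κ FB R₀ q₀ r t = -(R₀ ^ 3 * q₀ / FB) * R₀ * r * lcRegD3 R₀ r := by
  have hu := lcU_pos hR₀ hr h2r
  have hc : κ * FB / (2 * R₀ ^ 3 * q₀) ≠ 0 := by positivity
  have e : ∀ t ∈ uIcc (0 : ℝ) (2 * π), lcAvgWeightDr κ FB R₀ q₀ r t
      = -(R₀ ^ 3 * q₀ / FB) * R₀ * (R₀ ^ 3)⁻¹ * Real.cos t
        + -(R₀ ^ 3 * q₀ / FB) * R₀ * r * (Real.cos t * lcDivDiff3 R₀ r t) := by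
    intro t _
    have h := mul_lcDivDiff3 (r := r) (t := t) hR₀ (hu t)
    have hus : lcU R₀ r t * Real.sqrt (lcU R₀ r t) ≠ 0 :=
      mul_ne_zero (hu t).ne' (Real.sqrt_pos.2 (hu t)).ne'
    have e1 : lcAvgWeightDr κ FB R₀ q₀ r t
        = -(R₀ ^ 3 * q₀ / FB) * R₀ * Real.cos t * (lcU R₀ r t * Real.sqrt (lcU R₀ r t))⁻¹ := by
      unfold lcAvgWeightDr
      field_simp
    rw [e1, ← sub_add_cancel (lcU R₀ r t * Real.sqrt (lcU R₀ r t))⁻¹ (R₀ ^ 3)⁻¹, ← h]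
    ring
  obtain ⟨-, -, -, -, -, -, -, c3, -⟩ := continuous_regKernels (κ := κ) hκ.ne' hR₀ hr h2r
  rw [intervalIntegral.integral_congr e, intervalIntegral.integral_add, intervalIntegral.integral_const_mul,
    intervalIntegral.integral_const_mul, integral_cos, Real.sin_two_pi, Real.sin_zero]
  · unfold lcRegD3; ring
  · exact (continuous_const.mul Real.continuous_cos).intervalIntegrable _ _
  · exact (continuous_const.mul c3).intervalIntegrable _ _

omit hκ hFB hq₀ in
/-- `∫₀^{π} ∂/∂r (u√u)⁻¹ = −3R₀·r·D₅` (the `cos t·R₀⁻⁵` part integrates to `0` on `[0, π]`). [cite: Jardin2010, §8.5.4 eq. (8.134)] -/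
theorem integral_lcQKernelDr_eq_regD5 :
    ∫ t in (0 : ℝ)..π, lcQKernelDr R₀ r t = -(3 * R₀) * r * lcRegD5 R₀ r := by
  have hu := lcU_pos hR₀ hr h2r
  have e : ∀ t ∈ uIcc (0 : ℝ) π, lcQKernelDr R₀ r t
      = -(3 * R₀) * (R₀ ^ 5)⁻¹ * Real.cos t + -(3 * R₀) * r * (Real.cos t * lcDivDiff5 R₀ r t) := by
    intro t _
    have h := mul_lcDivDiff5 (r := r) (t := t) hR₀ (hu t)
    have hus : lcU R₀ r t ^ 2 * Real.sqrt (lcU R₀ r t) ≠ 0 :=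
      mul_ne_zero (pow_ne_zero 2 (hu t).ne') (Real.sqrt_pos.2 (hu t)).ne'
    have e1 : lcQKernelDr R₀ r t = -(3 * R₀) * Real.cos t * (lcU R₀ r t ^ 2 * Real.sqrt (lcU R₀ r t))⁻¹ := by
      unfold lcQKernelDr
      field_simp
    rw [e1, ← sub_add_cancel (lcU R₀ r t ^ 2 * Real.sqrt (lcU R₀ r t))⁻¹ (R₀ ^ 5)⁻¹, ← h]
    ring
  have hκ1 : (1 : ℝ) ≠ 0 := one_ne_zero
  obtain ⟨-, -, -, -, -, -, -, -, c5⟩ := continuous_regKernels (κ := 1) hκ1 hR₀ hr h2r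
  rw [intervalIntegral.integral_congr e, intervalIntegral.integral_add, intervalIntegral.integral_const_mul,
    intervalIntegral.integral_const_mul, integral_cos, Real.sin_pi, Real.sin_zero]
  · unfold lcRegD5; ring
  · exact (continuous_const.mul Real.continuous_cos).intervalIntegrable _ _
  · exact (continuous_const.mul c5).intervalIntegrable _ _

/-- `∫ w/|∇Ψ|² = (R₀³q₀/F_B)/(k²r²)·I₆`. [cite: Jardin2010, §5.3 eq. (5.30)] -/
theorem integral_w_div_gradSq_eq_regI6 :
    ∫ t in (0 : ℝ)..(2 * π), lcAvgWeight κ FB R₀ q₀ r t / lcGradSq κ FB R₀ q₀ r t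
      = R₀ ^ 3 * q₀ / FB / ((κ * FB / (R₀ ^ 2 * q₀)) ^ 2 * r ^ 2) * lcRegI6 κ R₀ r := by
  have hu := lcU_pos hR₀ hr h2r
  unfold lcRegI6
  rw [← intervalIntegral.integral_const_mul]
  refine intervalIntegral.integral_congr fun t _ => ?_
  rw [lcAvgWeight_eq hκ.ne' hFB.ne' hR₀.ne' hq₀.ne' (hu t), lcGradSq_eq_mul_lcQ, lcAmpSq_eq hR₀.ne']
  ring

/-- `∫ w/(u|∇Ψ|²) = (R₀³q₀/F_B)/(k²r²)·I₇`. [cite: Jardin2010, §5.3 eq. (5.30)] -/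
theorem integral_w_div_u_gradSq_eq_regI7 :
    ∫ t in (0 : ℝ)..(2 * π), lcAvgWeight κ FB R₀ q₀ r t / (lcU R₀ r t * lcGradSq κ FB R₀ q₀ r t)
      = R₀ ^ 3 * q₀ / FB / ((κ * FB / (R₀ ^ 2 * q₀)) ^ 2 * r ^ 2) * lcRegI7 κ R₀ r := by
  have hu := lcU_pos hR₀ hr h2r
  unfold lcRegI7
  rw [← intervalIntegral.integral_const_mul]
  refine intervalIntegral.integral_congr fun t _ => ?_
  rw [lcAvgWeight_eq hκ.ne' hFB.ne' hR₀.ne' hq₀.ne' (hu t), lcGradSq_eq_mul_lcQ, lcAmpSq_eq hR₀.ne']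
  ring

/-- `∫ u·w/|∇Ψ|² = (R₀³q₀/F_B)/(k²r²)·I₈`. [cite: Jardin2010, §5.3 eq. (5.30)] -/
theorem integral_u_w_div_gradSq_eq_regI8 :
    ∫ t in (0 : ℝ)..(2 * π), lcU R₀ r t / lcGradSq κ FB R₀ q₀ r t * lcAvgWeight κ FB R₀ q₀ r t
      = R₀ ^ 3 * q₀ / FB / ((κ * FB / (R₀ ^ 2 * q₀)) ^ 2 * r ^ 2) * lcRegI8 κ R₀ r := by
  have hu := lcU_pos hR₀ hr h2r
  unfold lcRegI8
  rw [← intervalIntegral.integral_const_mul]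
  refine intervalIntegral.integral_congr fun t _ => ?_
  rw [lcAvgWeight_eq hκ.ne' hFB.ne' hR₀.ne' hq₀.ne' (hu t), lcGradSq_eq_mul_lcQ, lcAmpSq_eq hR₀.ne']
  have hQ : lcQ κ R₀ r t ≠ 0 := (lcQ_pos hκ.ne' (hu t)).ne'
  set s := Real.sqrt (lcU R₀ r t) with hs_def
  have hs : s ≠ 0 := (Real.sqrt_pos.2 (hu t)).ne'
  have hss : s ^ 2 = lcU R₀ r t := Real.sq_sqrt (hu t).le
  rw [← hss]
  field_simp

omit hκ hFB hq₀ in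
/-- **First linear identity** `I₈ = R₀²·(I₆ + r·I_X)` (pointwise `√u = u·u^{−1/2}`, `u = R₀² + 2rR₀cos t`).
[folklore] -/
theorem lcRegI8_eq (hκ : κ ≠ 0) : lcRegI8 κ R₀ r = R₀ ^ 2 * (lcRegI6 κ R₀ r + r * lcRegIX κ R₀ r) := by
  have hu := lcU_pos hR₀ hr h2r
  obtain ⟨-, -, c6, -, -, cX, -, -, -⟩ := continuous_regKernels hκ hR₀ hr h2r
  have key : ∀ t ∈ uIcc (0 : ℝ) (2 * π), Real.sqrt (lcU R₀ r t) / lcQ κ R₀ r t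
      = R₀ ^ 2 * ((Real.sqrt (lcU R₀ r t))⁻¹ / lcQ κ R₀ r t)
        + R₀ ^ 2 * r * (2 * Real.cos t / R₀ * (Real.sqrt (lcU R₀ r t))⁻¹ / lcQ κ R₀ r t) := by
    intro t _
    have hQ : lcQ κ R₀ r t ≠ 0 := (lcQ_pos hκ (hu t)).ne'
    have hU : lcU R₀ r t = R₀ ^ 2 + 2 * r * R₀ * Real.cos t := rfl
    set s := Real.sqrt (lcU R₀ r t) with hs_def
    have hs : s ≠ 0 := (Real.sqrt_pos.2 (hu t)).ne'
    have hs2 : s ^ 2 = R₀ ^ 2 + 2 * r * R₀ * Real.cos t := (Real.sq_sqrt (hu t).le).trans hU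
    have hR : R₀ ≠ 0 := hR₀.ne'
    field_simp
    linear_combination hs2
  have i1 : IntervalIntegrable (fun t => R₀ ^ 2 * ((Real.sqrt (lcU R₀ r t))⁻¹ / lcQ κ R₀ r t)) volume 0 (2 * π) :=
    (c6.const_mul _).intervalIntegrable _ _
  have i2 : IntervalIntegrable (fun t => R₀ ^ 2 * r * (2 * Real.cos t / R₀ * (Real.sqrt (lcU R₀ r t))⁻¹
      / lcQ κ R₀ r t)) volume 0 (2 * π) := (cX.const_mul _).intervalIntegrable _ _
  unfold lcRegI8 lcRegI6 lcRegIX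
  rw [intervalIntegral.integral_congr key, intervalIntegral.integral_add i1 i2, intervalIntegral.integral_const_mul,
    intervalIntegral.integral_const_mul]
  ring

omit hκ hFB hq₀ in
/-- **Second linear identity** `R₀²·I₇ = I₆ − r·I_X + r²·I_Y` (pointwise `1/(1+η) = 1 − η + η²/(1+η)`, i.e.
`R₀² = u − (2r cos t/R₀)·u + 4r²cos²t`). [folklore] -/
theorem lcRegI7_eq (hκ : κ ≠ 0) :
    R₀ ^ 2 * lcRegI7 κ R₀ r = lcRegI6 κ R₀ r - r * lcRegIX κ R₀ r + r ^ 2 * lcRegIY κ R₀ r := by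
  have hu := lcU_pos hR₀ hr h2r
  obtain ⟨-, -, c6, c7, -, cX, cY, -, -⟩ := continuous_regKernels hκ hR₀ hr h2r
  have key : ∀ t ∈ uIcc (0 : ℝ) (2 * π), R₀ ^ 2 * ((lcU R₀ r t * Real.sqrt (lcU R₀ r t))⁻¹ / lcQ κ R₀ r t)
      = (Real.sqrt (lcU R₀ r t))⁻¹ / lcQ κ R₀ r t
          - r * (2 * Real.cos t / R₀ * (Real.sqrt (lcU R₀ r t))⁻¹ / lcQ κ R₀ r t)
        + r ^ 2 * (4 * Real.cos t ^ 2 * (lcU R₀ r t * Real.sqrt (lcU R₀ r t))⁻¹ / lcQ κ R₀ r t) := by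
    intro t _
    have hQ : lcQ κ R₀ r t ≠ 0 := (lcQ_pos hκ (hu t)).ne'
    have hne : lcU R₀ r t ≠ 0 := (hu t).ne'
    have hs : Real.sqrt (lcU R₀ r t) ≠ 0 := (Real.sqrt_pos.2 (hu t)).ne'
    have hU : lcU R₀ r t = R₀ ^ 2 + 2 * r * R₀ * Real.cos t := rfl
    have hR : R₀ ≠ 0 := hR₀.ne'
    field_simp
    rw [hU]
    ring
  have i1 : IntervalIntegrable (fun t => (Real.sqrt (lcU R₀ r t))⁻¹ / lcQ κ R₀ r t
      - r * (2 * Real.cos t / R₀ * (Real.sqrt (lcU R₀ r t))⁻¹ / lcQ κ R₀ r t)) volume 0 (2 * π) :=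
    (c6.sub (cX.const_mul r)).intervalIntegrable _ _
  have i2 : IntervalIntegrable (fun t => r ^ 2 * (4 * Real.cos t ^ 2 * (lcU R₀ r t * Real.sqrt (lcU R₀ r t))⁻¹
      / lcQ κ R₀ r t)) volume 0 (2 * π) := (cY.const_mul _).intervalIntegrable _ _
  have i3 : IntervalIntegrable (fun t => (Real.sqrt (lcU R₀ r t))⁻¹ / lcQ κ R₀ r t) volume 0 (2 * π) :=
    c6.intervalIntegrable _ _
  have i4 : IntervalIntegrable (fun t => r * (2 * Real.cos t / R₀ * (Real.sqrt (lcU R₀ r t))⁻¹ / lcQ κ R₀ r t))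
      volume 0 (2 * π) := (cX.const_mul r).intervalIntegrable _ _
  unfold lcRegI7 lcRegI6 lcRegIX lcRegIY
  rw [← intervalIntegral.integral_const_mul, intervalIntegral.integral_congr key,
    intervalIntegral.integral_add i1 i2, intervalIntegral.integral_sub i3 i4,
    intervalIntegral.integral_const_mul, intervalIntegral.integral_const_mul]

omit hκ hFB hq₀ in
/-- **The Cauchy–Schwarz defect without cancellation:** `R₀²·(I₆² − I₇I₈) = r²·(R₀²I_X² − I₈I_Y)`, i.e.
`⟨1/G⟩² − ⟨1/(R²G)⟩⟨R²/G⟩ = ⟨η/G⟩² − ⟨(1+η)/G⟩⟨η²/((1+η)G)⟩` (both right-hand terms are `O(r²)/r⁴`). [folklore] -/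
theorem lcReg_defect (hκ : κ ≠ 0) :
    R₀ ^ 2 * (lcRegI6 κ R₀ r ^ 2 - lcRegI7 κ R₀ r * lcRegI8 κ R₀ r)
      = r ^ 2 * (R₀ ^ 2 * lcRegIX κ R₀ r ^ 2 - lcRegI8 κ R₀ r * lcRegIY κ R₀ r) := by
  have h8 := lcRegI8_eq hR₀ hr h2r hκ
  have h7 := lcRegI7_eq hR₀ hr h2r hκ
  linear_combination (-(lcRegI8 κ R₀ r)) * h7 + (-(lcRegI6 κ R₀ r) + r * lcRegIX κ R₀ r) * h8

end identities


/-! ## §5 The slope and intercept ARE the regular numerators over `(k²rW₁)²`; the criterion in regular form -/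

section main

variable {R₀ κ FB q₀ r : ℝ} (hR₀ : 0 < R₀) (hκ : 0 < κ) (hFB : 0 < FB) (hq₀ : 0 < q₀)
  (hr : 0 < r) (h2r : 2 * r < R₀)

include hR₀ in
/-- `W₁ > 0` on every loop `0 ≤ r`, `2r < R₀` (including the axis). [folklore] -/
theorem lcRegI0_pos (hr : 0 ≤ r) (h2r : 2 * r < R₀) : 0 < lcRegI0 R₀ r := by
  have hu := lcU_pos hR₀ hr h2r
  obtain ⟨c0, -⟩ := continuous_regKernels (κ := 1) one_ne_zero hR₀ hr h2r
  unfold lcRegI0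
  exact intervalIntegral.intervalIntegral_pos_of_pos (c0.intervalIntegrable _ _)
    (fun t => inv_pos.2 (Real.sqrt_pos.2 (hu t))) (by positivity)

include hR₀ hκ hFB hq₀ hr h2r

/-- The five (8.134) ratios of the surface in regular form: `πΦ″/V′ = −3D₅/(kW₁)` (`g = 1`),
`V″/V′ = −D₃/(kW₁)`, `⟨1/G⟩ = I₆/(k²r²W₁)`, `⟨1/(uG)⟩ = I₇/(k²r²W₁)`, `⟨u/G⟩ = I₈/(k²r²W₁)`, `⟨1/u⟩ = I_B/W₁`.
[cite: Jardin2010, §8.5.4 eq. (8.134)] -/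
theorem lcGGJData_ratios_regular (a : ℝ) :
    π * (lcGGJData κ FB R₀ q₀ a 1 r).Φ'' / (lcGGJData κ FB R₀ q₀ a 1 r).V'
        = -3 * lcRegD5 R₀ r / (κ * FB / (R₀ ^ 2 * q₀) * lcRegI0 R₀ r)
    ∧ (lcGGJData κ FB R₀ q₀ a 1 r).V'' / (lcGGJData κ FB R₀ q₀ a 1 r).V'
        = -lcRegD3 R₀ r / (κ * FB / (R₀ ^ 2 * q₀) * lcRegI0 R₀ r)
    ∧ (∫ t in (0 : ℝ)..(2 * π), lcAvgWeight κ FB R₀ q₀ r t / lcGradSq κ FB R₀ q₀ r t)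
          / (∫ t in (0 : ℝ)..(2 * π), lcAvgWeight κ FB R₀ q₀ r t)
        = lcRegI6 κ R₀ r / ((κ * FB / (R₀ ^ 2 * q₀)) ^ 2 * r ^ 2 * lcRegI0 R₀ r)
    ∧ (∫ t in (0 : ℝ)..(2 * π), lcAvgWeight κ FB R₀ q₀ r t / (lcU R₀ r t * lcGradSq κ FB R₀ q₀ r t))
          / (∫ t in (0 : ℝ)..(2 * π), lcAvgWeight κ FB R₀ q₀ r t)
        = lcRegI7 κ R₀ r / ((κ * FB / (R₀ ^ 2 * q₀)) ^ 2 * r ^ 2 * lcRegI0 R₀ r)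
    ∧ (∫ t in (0 : ℝ)..(2 * π), lcU R₀ r t / lcGradSq κ FB R₀ q₀ r t * lcAvgWeight κ FB R₀ q₀ r t)
          / (∫ t in (0 : ℝ)..(2 * π), lcAvgWeight κ FB R₀ q₀ r t)
        = lcRegI8 κ R₀ r / ((κ * FB / (R₀ ^ 2 * q₀)) ^ 2 * r ^ 2 * lcRegI0 R₀ r)
    ∧ (∫ t in (0 : ℝ)..(2 * π), lcAvgWeight κ FB R₀ q₀ r t / lcU R₀ r t)
          / (∫ t in (0 : ℝ)..(2 * π), lcAvgWeight κ FB R₀ q₀ r t)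
        = lcRegIB R₀ r / lcRegI0 R₀ r := by
  have hW := lcRegI0_pos hR₀ hr.le h2r
  have hπ := Real.pi_pos
  rw [lcGGJData_Φ'' hR₀ hκ hFB hq₀ hr h2r a 1, lcGGJData_V' hR₀ hκ hFB hq₀ hr h2r a 1,
    lcGGJData_V'' hR₀ hκ hFB hq₀ hr h2r a 1, integral_lcQKernelDr_eq_regD5 hR₀ hr.le h2r,
    integral_lcAvgWeight_eq_regI0 hR₀ hκ hFB hq₀ hr.le h2r, integral_lcAvgWeightDr_eq_regD3 hR₀ hκ hFB hq₀ hr.le h2r,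
    integral_w_div_gradSq_eq_regI6 hR₀ hκ hFB hq₀ hr.le h2r, integral_w_div_u_gradSq_eq_regI7 hR₀ hκ hFB hq₀ hr.le h2r,
    integral_u_w_div_gradSq_eq_regI8 hR₀ hκ hFB hq₀ hr.le h2r, integral_lcAvgWeight_div_lcU_eq hR₀ hκ hFB hq₀ hr.le h2r]
  refine ⟨?_, ?_, ?_, ?_, ?_, ?_⟩ <;> field_simp

/-- **`N₂ = (k²rW₁)²·M₂`:** the axis-regular slope numerator is the slope times a positive square (`0 < r < R₀/2`).
[cite: Jardin2010, §8.5.4 eq. (8.134)] -/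
theorem lcRegSlopeNum_eq (a : ℝ) :
    lcRegSlopeNum κ FB R₀ q₀ r
      = ((κ * FB / (R₀ ^ 2 * q₀)) ^ 2 * r * lcRegI0 R₀ r) ^ 2 * lcMercierSlope κ FB R₀ q₀ a r := by
  have hW := lcRegI0_pos hR₀ hr.le h2r
  obtain ⟨hP, hV, hS, hB, hE, -⟩ := lcGGJData_ratios_regular hR₀ hκ hFB hq₀ hr h2r a
  have h8 := lcRegI8_eq hR₀ hr.le h2r hκ.ne'
  have h7 : lcRegI7 κ R₀ r = (lcRegI6 κ R₀ r - r * lcRegIX κ R₀ r + r ^ 2 * lcRegIY κ R₀ r) / R₀ ^ 2 := by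
    rw [eq_div_iff (pow_ne_zero 2 hR₀.ne'), mul_comm]
    exact lcRegI7_eq hR₀ hr.le h2r hκ.ne'
  unfold lcMercierSlope
  rw [mul_div_assoc (csLC κ FB R₀ q₀) (lcGGJData κ FB R₀ q₀ a 1 r).V'' (lcGGJData κ FB R₀ q₀ a 1 r).V',
    hP, hV, hS, hB, hE]
  unfold lcRegSlopeNum
  rw [h7, h8]
  field_simp
  ring

/-- **`N₀ = (k²rW₁)²·M₀`.** [cite: Jardin2010, §8.5.4 eq. (8.134)] -/
theorem lcRegInterceptNum_eq (a : ℝ) :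
    lcRegInterceptNum κ FB R₀ q₀ r
      = ((κ * FB / (R₀ ^ 2 * q₀)) ^ 2 * r * lcRegI0 R₀ r) ^ 2 * lcMercierIntercept κ FB R₀ q₀ a r := by
  have hW := lcRegI0_pos hR₀ hr.le h2r
  obtain ⟨-, hV, -, -, hE, hB0⟩ := lcGGJData_ratios_regular hR₀ hκ hFB hq₀ hr h2r a
  unfold lcMercierIntercept
  rw [mul_div_assoc (csLC κ FB R₀ q₀) (lcGGJData κ FB R₀ q₀ a 1 r).V'' (lcGGJData κ FB R₀ q₀ a 1 r).V',
    hV, hE, hB0]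
  unfold lcRegInterceptNum
  field_simp
  ring

/-- `N₀ > 0` (from `M₀ > 0`, `lcMercierIntercept_pos`). [cite: Jardin2010, §8.5.4 eq. (8.134)] -/
theorem lcRegInterceptNum_pos : 0 < lcRegInterceptNum κ FB R₀ q₀ r := by
  have hW := lcRegI0_pos hR₀ hr.le h2r
  rw [lcRegInterceptNum_eq hR₀ hκ hFB hq₀ hr h2r 0]
  have := lcMercierIntercept_pos hR₀ hκ hFB hq₀ hr h2r 0
  positivity

/-- `0 < M₂ ↔ 0 < N₂` (the surface is Mercier-stabilisable by a toroidal field iff the regular slope numerator is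
positive). [cite: Jardin2010, §8.5.4 eq. (8.134)] -/
theorem lcMercierSlope_pos_iff_regular (a : ℝ) :
    0 < lcMercierSlope κ FB R₀ q₀ a r ↔ 0 < lcRegSlopeNum κ FB R₀ q₀ r := by
  have hW := lcRegI0_pos hR₀ hr.le h2r
  have hF : 0 < ((κ * FB / (R₀ ^ 2 * q₀)) ^ 2 * r * lcRegI0 R₀ r) ^ 2 := by positivity
  rw [lcRegSlopeNum_eq hR₀ hκ hFB hq₀ hr h2r a]
  constructor
  · intro h; positivity
  · intro h; exact pos_of_mul_pos_right h hF.le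

/-- **THE MERCIER CRITERION IN AXIS-REGULAR FORM** (the statement a `ρ`-box kernel lane certifies cell by cell down
to the axis): on the surface `0 < r < R₀/2` of `Ψ = psiLC κ F_B R₀ q₀ a` with free constant `g`,
`MercierCriterion ↔ N₀(r) < g²·N₂(r)` — no slope hypothesis (since `N₀ > 0`, the inequality forces `N₂ > 0`).
MODELLED: ideal MHD, analytic fixed-boundary Solov'ev model; Mercier is a NECESSARY local criterion, not a stability
claim. [cite: Jardin2010, §8.5.4 eq. (8.134)] -/
theorem mercierCriterion_lcGGJData_iff_regular (a g : ℝ) :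
    (lcGGJData κ FB R₀ q₀ a g r).MercierCriterion
      ↔ lcRegInterceptNum κ FB R₀ q₀ r < g ^ 2 * lcRegSlopeNum κ FB R₀ q₀ r := by
  have hW := lcRegI0_pos hR₀ hr.le h2r
  have hF : 0 < ((κ * FB / (R₀ ^ 2 * q₀)) ^ 2 * r * lcRegI0 R₀ r) ^ 2 := by positivity
  have hN0 := lcRegInterceptNum_pos hR₀ hκ hFB hq₀ hr h2r
  rw [mercierCriterion_lcGGJData_iff hR₀ hκ hFB hq₀ hr h2r a g, lcRegSlopeNum_eq hR₀ hκ hFB hq₀ hr h2r a,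
    lcRegInterceptNum_eq hR₀ hκ hFB hq₀ hr h2r a]
  rw [lcRegInterceptNum_eq hR₀ hκ hFB hq₀ hr h2r a] at hN0
  set F := ((κ * FB / (R₀ ^ 2 * q₀)) ^ 2 * r * lcRegI0 R₀ r) ^ 2 with hF_def
  constructor
  · rintro ⟨-, h⟩
    calc F * lcMercierIntercept κ FB R₀ q₀ a r < F * (g ^ 2 * lcMercierSlope κ FB R₀ q₀ a r) :=
          mul_lt_mul_of_pos_left h hF
      _ = g ^ 2 * (F * lcMercierSlope κ FB R₀ q₀ a r) := by ring
  · intro h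
    have h' : F * lcMercierIntercept κ FB R₀ q₀ a r < F * (g ^ 2 * lcMercierSlope κ FB R₀ q₀ a r) := by
      calc F * lcMercierIntercept κ FB R₀ q₀ a r < g ^ 2 * (F * lcMercierSlope κ FB R₀ q₀ a r) := h
        _ = F * (g ^ 2 * lcMercierSlope κ FB R₀ q₀ a r) := by ring
    have h2 : lcMercierIntercept κ FB R₀ q₀ a r < g ^ 2 * lcMercierSlope κ FB R₀ q₀ a r :=
      lt_of_mul_lt_mul_left h' hF.le
    have hM0 := lcMercierIntercept_pos hR₀ hκ hFB hq₀ hr h2r a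
    refine ⟨?_, h2⟩
    by_contra hle
    push Not at hle
    have : g ^ 2 * lcMercierSlope κ FB R₀ q₀ a r ≤ 0 := mul_nonpos_of_nonneg_of_nonpos (sq_nonneg g) hle
    linarith

/-- For `g = F ≥ 0`: the criterion holds on the surface as soon as `N₀(r) < G²·N₂(r)` for some `0 ≤ G ≤ g` (monotone in
the free constant) — the form used with ONE certified `G` per `ρ`-cell. [cite: Jardin2010, §8.5.4 eq. (8.134)] -/
theorem mercierCriterion_lcGGJData_of_regular {a g G : ℝ} (hG : 0 ≤ G) (hGg : G ≤ g)
    (h : lcRegInterceptNum κ FB R₀ q₀ r < G ^ 2 * lcRegSlopeNum κ FB R₀ q₀ r) :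
    (lcGGJData κ FB R₀ q₀ a g r).MercierCriterion := by
  rw [mercierCriterion_lcGGJData_iff_regular hR₀ hκ hFB hq₀ hr h2r a g]
  have hN0 := lcRegInterceptNum_pos hR₀ hκ hFB hq₀ hr h2r
  have hN2 : 0 < lcRegSlopeNum κ FB R₀ q₀ r := by
    by_contra hle
    push Not at hle
    have : G ^ 2 * lcRegSlopeNum κ FB R₀ q₀ r ≤ 0 := mul_nonpos_of_nonneg_of_nonpos (sq_nonneg G) hle
    linarith
  have hsq : G ^ 2 ≤ g ^ 2 := pow_le_pow_left₀ hG hGg 2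
  calc lcRegInterceptNum κ FB R₀ q₀ r < G ^ 2 * lcRegSlopeNum κ FB R₀ q₀ r := h
    _ ≤ g ^ 2 * lcRegSlopeNum κ FB R₀ q₀ r := mul_le_mul_of_nonneg_right hsq hN2.le

/-- Conversely `g²·N₂(r) ≤ N₀(r)` refutes the criterion on the surface (the instability side of a cell certificate).
[cite: Jardin2010, §8.5.4 eq. (8.134)] -/
theorem not_mercierCriterion_lcGGJData_of_regular {a g : ℝ}
    (h : g ^ 2 * lcRegSlopeNum κ FB R₀ q₀ r ≤ lcRegInterceptNum κ FB R₀ q₀ r) :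
    ¬ (lcGGJData κ FB R₀ q₀ a g r).MercierCriterion := by
  rw [mercierCriterion_lcGGJData_iff_regular hR₀ hκ hFB hq₀ hr h2r a g]
  exact not_lt.mpr h

/-- The Mercier threshold of the surface in regular form: `g_M(r) = √(N₀(r)/N₂(r))` (the positive square factor
cancels; no hypothesis on the sign of `N₂`). [cite: Jardin2010, §8.5.4 eq. (8.134)] -/
theorem lcMercierThreshold_eq_regular (a : ℝ) :
    lcMercierThreshold κ FB R₀ q₀ a r
      = Real.sqrt (lcRegInterceptNum κ FB R₀ q₀ r / lcRegSlopeNum κ FB R₀ q₀ r) := by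
  have hW := lcRegI0_pos hR₀ hr.le h2r
  have hF : ((κ * FB / (R₀ ^ 2 * q₀)) ^ 2 * r * lcRegI0 R₀ r) ^ 2 ≠ 0 := by positivity
  unfold lcMercierThreshold
  rw [lcRegSlopeNum_eq hR₀ hκ hFB hq₀ hr h2r a, lcRegInterceptNum_eq hR₀ hκ hFB hq₀ hr h2r a,
    mul_div_mul_left _ _ hF]

end main



end LcMercierRegular

end Summit.Ventures.FusionMHD.Models

end
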